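import Mathlib.Analysis.Calculus.Deriv.MeanValue
import Mathlib.Analysis.SpecialFunctions.Log.NegMulLog
import Mathlib.Analysis.Complex.ExponentialBounds
import Summits.RiemannHypothesis.RiemannHypothesis.Theorems.IntegerScrewPsiDeriv
import Literature.NumberTheory.Transcendental.ZudilinSaddle
import HarnessLib

/-!
# RH-FREE: the cusp expansion of Suzuki's screw function `Ψ = zetaScrew` at `t = 0⁺`

For `0 < t ≤ 1/2` (inside the prime-free wall `|t| < log 2`),

  `|Ψ(t) − ((t/2)·log(1/t) + ((1 − γ₀ − log 2π)/2)·t)| ≤ 6·t²`     (`abs_zetaScrew_sub_cusp_le`),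

with the constant `(1 − γ₀ − log 2π)/2 = −0.70754…` IDENTIFIED (not fitted), and its consequence for the
top second difference used by the screw column's P3 theory (sos-theory, `HOME/sos/lean/CuspSketch.lean`,
ADDENDUM B §B1):

  `|M·(Ψ(log(M/(M−1))) + Ψ(log((M−1)/(M−2))) − Ψ(log(M/(M−2)))) − log 2| ≤ C/M`  (`M ≥ 8`, `psiDefTopLaw`).

Method (elementary, no digamma / Bernoulli theory): the tree already has the CLOSED FORM of `Ψ'` on
`(0, log 2)` (`IntegerScrewPsiDeriv.hasDerivAt_zetaScrew`:
`Ψ'(t) = 2(e^{t/2} − e^{−t/2}) − (γ₀ + π/2 + 3 log 2 + log π)/2 + artanh(e^{−t/2}) + arctan(e^{−t/2})`).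
Subtracting the derivative of the main term, `(1/2)log(1/t) − 1/2 + (1 − γ₀ − log 2π)/2`, the constants
cancel EXACTLY (`log 2π = log 2 + log π`, `arctan 1 = π/4`, `−log(1 − e^{−t/2}) = log(1/t) + log 2 + O(t)`),
leaving four elementary `O(t)` pieces (`abs_zetaScrewDeriv_sub_cuspDeriv_le`, bound `6t`); the mean value
theorem on `[0, t]` (`Ψ(0) = 0`, `Ψ` continuous) gives the `6t²` remainder.  The top law follows from the
expansion at the three points `a = log(M/(M−1))`, `b = log((M−1)/(M−2))`, `a + b`, where the linear terms
cancel and `a·log((a+b)/a) + b·log((a+b)/b) = (a+b)·log 2 + O(1/M²)`.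

RH-FREE throughout: statements about the explicit archimedean part of Suzuki2023 (1.1) near `0`; the source's
own form of the expansion is the Lerch expansion in the proof of Suzuki2023 Thm 1.5 (§6.1),
`C − e^{−t/2}Φ(e^{−2t},2,1/4) = 2t·log(1/t) + (π + 4 log 2 + 2)·t + O(t²)`.  Nothing here bears on the truth
of RH.  References: M. Suzuki, J. Lond. Math. Soc. (2) 108 (2023) [Suzuki2023]; the estimates are [folklore].
-/

set_option linter.dupNamespace false
set_option autoImplicit false

noncomputable section

open Real Set

namespace Summit.RiemannHypothesis.RiemannHypothesis.Theorems.IntegerScrew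

open Literature.NumberTheory.LFunctions

/-! ## Three elementary `O(t)` estimates (`arctan` is `1`-Lipschitz: `Zudilin2004.abs_arctan_sub_arctan_le`) -/

/-- `|e^{t/2} − e^{−t/2}| ≤ 2|t|` for `|t| ≤ 1`. [folklore] -/
theorem abs_exp_half_sub_exp_neg_half_le {t : ℝ} (ht : |t| ≤ 1) :
    |Real.exp (t / 2) - Real.exp (-(t / 2))| ≤ 2 * |t| := by
  have h1 : |t / 2| ≤ 1 := by
    rw [abs_div, abs_two]; linarith [abs_nonneg t]
  have h2 : |(-(t / 2))| ≤ 1 := by rw [abs_neg]; exact h1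
  have e1 := Real.abs_exp_sub_one_le h1
  have e2 := Real.abs_exp_sub_one_le h2
  have hsplit : Real.exp (t / 2) - Real.exp (-(t / 2))
      = (Real.exp (t / 2) - 1) - (Real.exp (-(t / 2)) - 1) := by ring
  calc |Real.exp (t / 2) - Real.exp (-(t / 2))|
      = |(Real.exp (t / 2) - 1) - (Real.exp (-(t / 2)) - 1)| := by rw [hsplit]
    _ ≤ |Real.exp (t / 2) - 1| + |Real.exp (-(t / 2)) - 1| := abs_sub _ _
    _ ≤ 2 * |t / 2| + 2 * |(-(t / 2))| := add_le_add e1 e2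
    _ = 2 * |t| := by rw [abs_neg, abs_div, abs_two]; ring

/-- `|log(1 + e^{−t/2}) − log 2| ≤ t/2` for `t > 0`. [folklore] -/
theorem abs_log_one_add_exp_sub_log_two_le {t : ℝ} (ht : 0 < t) :
    |Real.log (1 + Real.exp (-(t / 2))) - Real.log 2| ≤ t / 2 := by
  set w := Real.exp (-(t / 2)) with hw
  have hw0 : 0 < w := Real.exp_pos _
  have hw1 : w < 1 := by rw [hw, Real.exp_lt_one_iff]; linarith
  have hwt : 1 - t / 2 ≤ w := by have := Real.add_one_le_exp (-(t / 2)); linarith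
  have hz : 0 < (1 + w) / 2 := by positivity
  have hlog : Real.log (1 + w) - Real.log 2 = Real.log ((1 + w) / 2) := by
    rw [Real.log_div (by positivity) (by norm_num)]
  rw [hlog]
  have hup : Real.log ((1 + w) / 2) ≤ 0 := Real.log_nonpos hz.le (by linarith)
  have hlow : 1 - ((1 + w) / 2)⁻¹ ≤ Real.log ((1 + w) / 2) := Real.one_sub_inv_le_log_of_pos hz
  rw [inv_div] at hlow
  rw [abs_of_nonpos hup]
  have h3 : 2 / (1 + w) - 1 ≤ t / 2 := by
    rw [div_sub_one (by positivity), div_le_iff₀ (by positivity)]; nlinarith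
  linarith

/-- `|log 2 + log(1 − e^{−t/2}) + log(1/t)| ≤ t` for `0 < t ≤ 1`
(`2(1 − e^{−t/2})/t ∈ [1 − t/2, 1]`). [folklore] -/
theorem abs_log_two_add_log_one_sub_exp_add_log_inv_le {t : ℝ} (ht : 0 < t) (ht1 : t ≤ 1) :
    |Real.log 2 + Real.log (1 - Real.exp (-(t / 2))) + Real.log (1 / t)| ≤ t := by
  set w := Real.exp (-(t / 2)) with hw
  have hw1 : w < 1 := by rw [hw, Real.exp_lt_one_iff]; linarith
  have hwt : 1 - t / 2 ≤ w := by have := Real.add_one_le_exp (-(t / 2)); linarith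
  have hwt2 : w ≤ 1 - t / 2 + t ^ 2 / 4 := by
    have habs : |(-(t / 2))| ≤ 1 := by rw [abs_neg, abs_of_pos (by linarith)]; linarith
    have h := (abs_le.mp (Real.abs_exp_sub_one_sub_id_le habs)).2
    nlinarith [h]
  have h1w : 0 < 1 - w := by linarith
  set z := 2 * (1 - w) / t with hz
  have hzpos : 0 < z := div_pos (by linarith) ht
  have hz1 : z ≤ 1 := by rw [hz, div_le_one ht]; linarith
  have hzlow : 1 - t / 2 ≤ z := by rw [hz, le_div_iff₀ ht]; nlinarith
  have hlogz : Real.log z = Real.log 2 + Real.log (1 - w) + Real.log (1 / t) := by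
    rw [hz, Real.log_div (by positivity) ht.ne', Real.log_mul (by norm_num) h1w.ne', one_div,
      Real.log_inv]
    ring
  rw [← hlogz]
  have hup : Real.log z ≤ 0 := Real.log_nonpos hzpos.le hz1
  have hlow : 1 - z⁻¹ ≤ Real.log z := Real.one_sub_inv_le_log_of_pos hzpos
  rw [abs_of_nonpos hup]
  have hzhalf : 1 / 2 ≤ z := by linarith
  have h3 : z⁻¹ - 1 ≤ t := by
    rw [inv_eq_one_div, div_sub_one hzpos.ne', div_le_iff₀ hzpos]; nlinarith
  linarith

/-! ## The derivative remainder is `O(t)` -/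

/-- **Derivative form of the cusp expansion.** For `0 < t ≤ 1/2`,
`|Ψ'(t) − ((1/2)log(1/t) − 1/2 + (1 − γ₀ − log 2π)/2)| ≤ 6t`; the constants cancel exactly
(`log 2π = log 2 + log π`, `arctan 1 = π/4`). [folklore] -/
theorem abs_zetaScrewDeriv_sub_cuspDeriv_le {t : ℝ} (ht : 0 < t) (ht2 : t ≤ 1 / 2) :
    |zetaScrewDeriv t - (1 / 2 * Real.log (1 / t) - 1 / 2
        + (1 - Real.eulerMascheroniConstant - Real.log (2 * Real.pi)) / 2)| ≤ 6 * t := by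
  have hA := abs_exp_half_sub_exp_neg_half_le (t := t) (by rw [abs_of_pos ht]; linarith)
  rw [abs_of_pos ht] at hA
  have hB := abs_log_one_add_exp_sub_log_two_le ht
  have hC := abs_log_two_add_log_one_sub_exp_add_log_inv_le ht (by linarith)
  have hD : |Real.arctan (Real.exp (-(t / 2))) - Real.pi / 4| ≤ t / 2 := by
    have h := Literature.NumberTheory.Transcendental.Zudilin2004.abs_arctan_sub_arctan_le
      (Real.exp (-(t / 2))) 1
    rw [Real.arctan_one] at h
    have hwt : 1 - t / 2 ≤ Real.exp (-(t / 2)) := by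
      have := Real.add_one_le_exp (-(t / 2)); linarith
    have hw1 : Real.exp (-(t / 2)) ≤ 1 := by rw [Real.exp_le_one_iff]; linarith
    rw [abs_of_nonpos (by linarith : Real.exp (-(t / 2)) - 1 ≤ 0)] at h
    linarith
  have hlog2pi : Real.log (2 * Real.pi) = Real.log 2 + Real.log Real.pi :=
    Real.log_mul (by norm_num) Real.pi_pos.ne'
  -- names for the four pieces
  set A := Real.exp (t / 2) - Real.exp (-(t / 2)) with hAdef
  set B := Real.log (1 + Real.exp (-(t / 2))) - Real.log 2 with hBdef
  set C := Real.log 2 + Real.log (1 - Real.exp (-(t / 2))) + Real.log (1 / t) with hCdef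
  set D := Real.arctan (Real.exp (-(t / 2))) - Real.pi / 4 with hDdef
  have key : zetaScrewDeriv t - (1 / 2 * Real.log (1 / t) - 1 / 2
        + (1 - Real.eulerMascheroniConstant - Real.log (2 * Real.pi)) / 2)
      = 2 * A + B / 2 - C / 2 + D := by
    simp only [zetaScrewDeriv, hAdef, hBdef, hCdef, hDdef, hlog2pi]
    ring
  rw [key]
  have h1 : |2 * A + B / 2 - C / 2 + D| ≤ |2 * A| + |B / 2| + |C / 2| + |D| := by
    have e1 := abs_add_le (2 * A + B / 2 - C / 2) D
    have e2 := abs_sub (2 * A + B / 2) (C / 2)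
    have e3 := abs_add_le (2 * A) (B / 2)
    linarith
  have h2A : |2 * A| = 2 * |A| := by rw [abs_mul, abs_two]
  have h2B : |B / 2| = |B| / 2 := by rw [abs_div, abs_two]
  have h2C : |C / 2| = |C| / 2 := by rw [abs_div, abs_two]
  rw [h2A, h2B, h2C] at h1
  linarith

/-! ## The cusp expansion of `Ψ` -/

/-- **Cusp expansion of Suzuki's `Ψ` at `0⁺` (RH-free, identified constant).** For `0 < t ≤ 1/2`,
`|Ψ(t) − ((t/2)log(1/t) + ((1 − γ₀ − log 2π)/2)·t)| ≤ 6t²`.  Mean value theorem on `[0, t]` with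
`Ψ(0) = 0`, `Ψ` continuous, and the derivative remainder bound `6t`. [folklore] -/
theorem abs_zetaScrew_sub_cusp_le {t : ℝ} (ht : 0 < t) (ht2 : t ≤ 1 / 2) :
    |zetaScrew t - (t / 2 * Real.log (1 / t)
        + (1 - Real.eulerMascheroniConstant - Real.log (2 * Real.pi)) / 2 * t)| ≤ 6 * t ^ 2 := by
  set c := (1 - Real.eulerMascheroniConstant - Real.log (2 * Real.pi)) / 2 with hc
  set R : ℝ → ℝ := fun y => zetaScrew y - (y / 2 * Real.log (1 / y) + c * y) with hR
  set E : ℝ → ℝ := fun y => zetaScrewDeriv y - (1 / 2 * Real.log (1 / y) - 1 / 2 + c) with hE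
  have hlog2 : (1 : ℝ) / 2 < Real.log 2 := by
    have := Real.log_two_gt_d9; norm_num at this ⊢; linarith
  -- continuity of `R` (the main term is `−(1/2)·(y log y) + c·y`)
  have hm : Continuous fun y : ℝ => y / 2 * Real.log (1 / y) + c * y := by
    have e : (fun y : ℝ => y / 2 * Real.log (1 / y) + c * y)
        = fun y => -(1 / 2) * (y * Real.log y) + c * y := by
      funext y; rw [one_div, Real.log_inv]; ring
    rw [e]
    exact (continuous_const.mul Real.continuous_mul_log).add (continuous_const.mul continuous_id)
  have hRcont : ContinuousOn R (Icc 0 t) := (continuous_zetaScrew.sub hm).continuousOn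
  -- derivative of `R` on `(0, t)`
  have hRderiv : ∀ y ∈ Ioo 0 t, HasDerivAt R (E y) y := by
    intro y hy
    have hy0 : 0 < y := hy.1
    have hy2 : y < Real.log 2 := by linarith [hy.2]
    have h1 := hasDerivAt_zetaScrew hy0 hy2
    have h2 : HasDerivAt (fun y : ℝ => y / 2 * Real.log (1 / y) + c * y)
        (1 / 2 * Real.log (1 / y) - 1 / 2 + c) y := by
      have hml := Real.hasDerivAt_mul_log hy0.ne'
      have h := (hml.const_mul (-(1 / 2))).add ((hasDerivAt_id y).const_mul c)
      have e : (fun y : ℝ => y / 2 * Real.log (1 / y) + c * y)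
          = fun y => -(1 / 2) * (y * Real.log y) + c * id y := by
        funext y; rw [one_div, Real.log_inv]; simp only [id]; ring
      rw [e]
      refine h.congr_deriv ?_
      simp only [one_div, Real.log_inv, mul_one]; ring
    exact h1.sub h2
  obtain ⟨ξ, hξ, hslope⟩ := exists_hasDerivAt_eq_slope R E ht hRcont hRderiv
  have hR0 : R 0 = 0 := by simp [hR, zetaScrew_zero]
  rw [hR0, sub_zero, sub_zero, eq_div_iff ht.ne'] at hslope
  have hEξ : |E ξ| ≤ 6 * ξ := abs_zetaScrewDeriv_sub_cuspDeriv_le hξ.1 (by linarith [hξ.2])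
  have hRt : R t = E ξ * t := hslope.symm
  show |R t| ≤ 6 * t ^ 2
  calc |R t| = |E ξ| * t := by rw [hRt, abs_mul, abs_of_pos ht]
    _ ≤ 6 * ξ * t := by gcongr
    _ ≤ 6 * t ^ 2 := by nlinarith [hξ.2, hξ.1]

/-- The cusp expansion in the `∃ C` form of sos-theory's sketch `ZetaScrewCuspExpansion`
(`HOME/sos/lean/CuspSketch.lean`), verbatim. [folklore] -/
theorem zetaScrewCuspExpansion :
    ∃ C : ℝ, ∀ t : ℝ, 0 < t → t ≤ 1 / 2 →
      |zetaScrew t - (t / 2 * Real.log (1 / t)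
          + (1 - Real.eulerMascheroniConstant - Real.log (2 * Real.pi)) / 2 * t)| ≤ C * t ^ 2 :=
  ⟨6, fun _ ht ht2 => abs_zetaScrew_sub_cusp_le ht ht2⟩

end Summit.RiemannHypothesis.RiemannHypothesis.Theorems.IntegerScrew

end
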